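import Summits.RiemannHypothesis.RiemannHypothesis.Theorems.Splittings.SplitXWucStarRowB
import Summits.RiemannHypothesis.RiemannHypothesis.Theorems.Splittings.SplitXWucK1RA
import HarnessLib

/-!
# x-wuc GEN-11 row ★₁₀₂₄ʳ — `HSW → K1′ → (RH ⟺ RH(e^1024) ∧ B′₁([−1,1]))` — tree port, part C (3/4)

Part C: the RIDGE package `KCertRidge.{linear_coeff_eq_zero, J_continuous, J_exists_min, J_foc, ridge_package}`, the L²-bridges `KCertBridge.{coeFn_finset_sum, conj_kernel}`, `locBandL_mass_lower` and the certificate chain `cert_chain` (over the K1R port's `KCertRidge.J`, `KCertBridge.*`, `tfT`, `Phi` — `SplitXWucK1RA`).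
Provenance, deltas and HONEST LABEL as in part A (`SplitXWucStarRowA.lean`): declarations verbatim from G11b 3a3eefe13ea0264d,
re-targeted onto the tree twins; CONDITIONAL bookkeeping; RH is not proved by this; nothing here bears on the truth of RH.
-/

-- D-0017: `Summit.RiemannHypothesis.RiemannHypothesis.…` duplicates the namespace BY DESIGN (single-problem summit).
set_option linter.dupNamespace false
noncomputable section

namespace Summit.RiemannHypothesis.RiemannHypothesis.Theorems.Splittings.XWucG8

open scoped Classical ComplexConjugate InnerProductSpace
open Set Filter Topology Complex MeasureTheory
open Literature.NumberTheory.LFunctions Literature.NumberTheory.LFunctions.Bombieri2000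
open Summit.RiemannHypothesis.RiemannHypothesis.Theses.RuelleBand
open Summit.RiemannHypothesis.RiemannHypothesis.Theorems.Splittings.BombieriTruncEigen
open Summit.RiemannHypothesis.RiemannHypothesis.Theorems.Splittings.BombieriFozNoDep
open Summit.RiemannHypothesis.RiemannHypothesis.Theorems.Splittings.BombieriTruncGram
open Summit.RiemannHypothesis.RiemannHypothesis.Theorems.Splittings.BombieriTruncPairing
open Summit.RiemannHypothesis.RiemannHypothesis.Theorems.Splittings.BombieriTruncScreening
open Summit.RiemannHypothesis.RiemannHypothesis.Theorems.Splittings.BombieriTruncBandGap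
open Summit.RiemannHypothesis.RiemannHypothesis.Theorems.Splittings.BombieriTruncMultiplicity
open Summit.RiemannHypothesis.RiemannHypothesis.Theorems.Splittings.BombieriTruncEventualStrip
open Summit.RiemannHypothesis.RiemannHypothesis.Theorems.Splittings.BombieriTruncExactness
open Summit.RiemannHypothesis.RiemannHypothesis.Theorems.Splittings.BombieriTruncClump
open Summit.RiemannHypothesis.RiemannHypothesis.Theorems.Splittings.BombieriTruncOffLineSparse
open Summit.RiemannHypothesis.RiemannHypothesis.Theorems.Splittings.BombieriTruncSynthesis
open Summit.RiemannHypothesis.RiemannHypothesis.Theorems.Splittings.BombieriTruncSynthesisScreening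
open Summit.RiemannHypothesis.RiemannHypothesis.Theorems.Splittings.BombieriTruncSynthesisRows
open Literature.NumberTheory.DiophantineGeometry (RiemannHypothesisUpTo)
open Summit.RiemannHypothesis.RiemannHypothesis.Theorems.Splittings.BombieriTruncMassAware
open Summit.RiemannHypothesis.RiemannHypothesis.Theorems.Splittings.MassAwareSamplingCeiling
variable {N : ℕ}

namespace KCertRidge

/-- `a*s^2 + b*s ≥ 0` for all real `s` (with `a ≥ 0`) forces `b = 0`. -/
lemma linear_coeff_eq_zero {a b : ℝ} (ha : 0 ≤ a) (h : ∀ s : ℝ, 0 ≤ a * s ^ 2 + b * s) : b = 0 := by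
  by_contra hb
  have hb2 : 0 < b ^ 2 := by positivity
  have ht0 : (0 : ℝ) < 1 / (2 * (a + 1)) := by positivity
  have hat : a * (1 / (2 * (a + 1))) < 1 := by
    rw [mul_one_div, div_lt_one (by positivity)]; nlinarith
  have := h (-(b * (1 / (2 * (a + 1)))))
  -- a b² t² - b² t = b² t (a t - 1) < 0
  have key : a * (-(b * (1 / (2 * (a + 1))))) ^ 2 + b * (-(b * (1 / (2 * (a + 1)))))
      = b ^ 2 * (1 / (2 * (a + 1))) * (a * (1 / (2 * (a + 1))) - 1) := by ring
  rw [key] at this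
  have : b ^ 2 * (1 / (2 * (a + 1))) * (a * (1 / (2 * (a + 1))) - 1) < 0 :=
    mul_neg_of_pos_of_neg (mul_pos hb2 ht0) (by linarith)
  linarith

variable {E : Type*} [NormedAddCommGroup E] [InnerProductSpace ℂ E]

/-- ★-row port (x-wuc G11b «row ★₁₀₂₄ʳ», verbatim): auxiliary lemma `J_continuous` of the chain HSW → K1′ → (RH ⟺ RH(e^1024) ∧ B′₁) — see the module docstring of part A. -/
lemma J_continuous {n : ℕ} (G : E) (Φ : Fin n → E) (w : Fin n → ℝ) : Continuous (J G Φ w) := by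
  unfold J; fun_prop

/-- Existence of a global minimiser of `J` over `ℂⁿ`. -/
lemma J_exists_min {n : ℕ} (G : E) (Φ : Fin n → E) (w : Fin n → ℝ) (hw : ∀ k, 0 < w k) :
    ∃ b₀ : Fin n → ℂ, ∀ b, J G Φ w b₀ ≤ J G Φ w b := by
  set W : ℝ := ∑ k, w k with hW
  have hWk : ∀ k, w k ≤ W := fun k ↦
    Finset.single_le_sum (f := w) (fun j _ ↦ (hw j).le) (Finset.mem_univ k)
  set R : ℝ := max 1 (W * ‖G‖ ^ 2) with hR
  have hR1 : 1 ≤ R := le_max_left _ _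
  have hR2 : W * ‖G‖ ^ 2 ≤ R := le_max_right _ _
  obtain ⟨b₀, hb₀mem, hb₀⟩ := (isCompact_closedBall (0 : Fin n → ℂ) R).exists_isMinOn
    ⟨0, Metric.mem_closedBall_self (by linarith)⟩ (J_continuous G Φ w).continuousOn
  refine ⟨b₀, fun b ↦ ?_⟩
  by_cases hb : b ∈ Metric.closedBall (0 : Fin n → ℂ) R
  · exact hb₀ hb
  · -- outside the ball some coordinate is large, and the penalty alone exceeds J 0 ≥ J b₀
    have hJ0 : J G Φ w b₀ ≤ J G Φ w 0 := hb₀ (Metric.mem_closedBall_self (by linarith))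
    have hJ0' : J G Φ w 0 = ‖G‖ ^ 2 := by simp [J]
    rw [Metric.mem_closedBall, dist_zero_right, not_le] at hb
    obtain ⟨k, hk⟩ : ∃ k, R < ‖b k‖ := by
      by_contra hcon
      push Not at hcon
      exact absurd (pi_norm_le_iff_of_nonneg (by linarith) |>.2 hcon) (not_le.2 hb)
    have hwk := hw k
    have h1 : ‖b k‖ ^ 2 / w k ≤ ∑ j, ‖b j‖ ^ 2 / w j :=
      Finset.single_le_sum (f := fun j ↦ ‖b j‖ ^ 2 / w j) (fun j _ ↦ by have := hw j; positivity)
        (Finset.mem_univ k)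
    have h2 : ∑ j, ‖b j‖ ^ 2 / w j ≤ J G Φ w b := by unfold J; nlinarith [norm_nonneg (G - ∑ j, b j • Φ j)]
    have h3 : R ^ 2 / W ≤ ‖b k‖ ^ 2 / w k := by
      have hWpos : 0 < W := lt_of_lt_of_le hwk (hWk k)
      rw [div_le_div_iff₀ hWpos hwk]
      have : R ^ 2 ≤ ‖b k‖ ^ 2 := by nlinarith [norm_nonneg (b k)]
      nlinarith [hWk k, this, sq_nonneg R]
    have h4 : ‖G‖ ^ 2 ≤ R ^ 2 / W := by
      have hWpos : 0 < W := lt_of_lt_of_le hwk (hWk k)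
      rw [le_div_iff₀ hWpos]
      nlinarith [hR1, hR2, sq_nonneg ‖G‖]
    linarith

/-- FIRST-ORDER CONDITION at a minimiser: `b₀ k = w k * ⟪Φ k, F⟫` with `F = G − Σ b₀_j • Φ_j`. -/
lemma J_foc {n : ℕ} (G : E) (Φ : Fin n → E) (w : Fin n → ℝ) (hw : ∀ k, 0 < w k) (b₀ : Fin n → ℂ)
    (hmin : ∀ b, J G Φ w b₀ ≤ J G Φ w b) (k : Fin n) :
    b₀ k = (w k : ℂ) * ⟪Φ k, G - ∑ j, b₀ j • Φ j⟫_ℂ := by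
  set F : E := G - ∑ j, b₀ j • Φ j with hF
  -- perturb coordinate k by s*c
  have key : ∀ (c : ℂ) (s : ℝ),
      J G Φ w (b₀ + Pi.single k ((s : ℂ) * c)) - J G Φ w b₀
        = (‖c • Φ k‖ ^ 2 + ‖c‖ ^ 2 / w k) * s ^ 2
          + (-2 * RCLike.re ⟪F, c • Φ k⟫_ℂ + 2 * RCLike.re (conj (b₀ k) * c) / w k) * s := by
    intro c s
    set e : Fin n → ℂ := Pi.single k ((s : ℂ) * c) with he
    have hej : ∀ j, e j = if j = k then (s : ℂ) * c else 0 := by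
      intro j; rw [he, Pi.single_apply]
    have hsum : ∑ j, (b₀ j + e j) • Φ j = (∑ j, b₀ j • Φ j) + ((s : ℂ) * c) • Φ k := by
      simp only [add_smul, Finset.sum_add_distrib]
      congr 1
      rw [Finset.sum_eq_single k]
      · rw [hej, if_pos rfl]
      · intro j _ hj; rw [hej, if_neg hj, zero_smul]
      · intro hk; exact absurd (Finset.mem_univ k) hk
    have hres : G - ∑ j, (b₀ j + e j) • Φ j = F - (s : ℂ) • (c • Φ k) := by
      rw [hsum, hF, smul_smul]; abel
    have hpen : ∑ j, ‖b₀ j + e j‖ ^ 2 / w j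
        = (∑ j, ‖b₀ j‖ ^ 2 / w j) + (‖b₀ k + (s : ℂ) * c‖ ^ 2 - ‖b₀ k‖ ^ 2) / w k := by
      have : ∀ j, ‖b₀ j + e j‖ ^ 2 / w j
          = ‖b₀ j‖ ^ 2 / w j + (if j = k then (‖b₀ k + (s : ℂ) * c‖ ^ 2 - ‖b₀ k‖ ^ 2) / w k else 0) := by
        intro j
        by_cases hj : j = k
        · subst hj; rw [hej, if_pos rfl, if_pos rfl]; ring
        · rw [hej, if_neg hj, if_neg hj, add_zero, add_zero]
      simp_rw [this, Finset.sum_add_distrib, Finset.sum_ite_eq' Finset.univ k, Finset.mem_univ, if_true]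
    unfold J
    simp only [Pi.add_apply]
    rw [hres, hpen, @norm_sub_sq ℂ, @norm_add_sq ℂ, ← hF]
    simp only [norm_smul, norm_mul, inner_smul_right, Complex.norm_real, Real.norm_eq_abs, mul_pow, sq_abs,
      RCLike.re_to_complex]
    rw [RCLike.inner_apply']
    simp only [Complex.mul_re, Complex.mul_im, Complex.ofReal_re, Complex.ofReal_im, Complex.conj_re,
      Complex.conj_im, zero_mul, sub_zero, add_zero]
    ring
  -- minimality ⇒ the linear coefficient vanishes for every direction c
  have hlin : ∀ c : ℂ, -2 * RCLike.re ⟪F, c • Φ k⟫_ℂ + 2 * RCLike.re (conj (b₀ k) * c) / w k = 0 := by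
    intro c
    apply linear_coeff_eq_zero (a := ‖c • Φ k‖ ^ 2 + ‖c‖ ^ 2 / w k) (by have := hw k; positivity)
    intro s
    rw [← key c s]
    linarith [hmin (b₀ + Pi.single k ((s : ℂ) * c))]
  -- choose c = conj z with z = conj(b₀ k)/w k - ⟪F, Φ k⟫
  set z : ℂ := conj (b₀ k) / (w k : ℂ) - ⟪F, Φ k⟫_ℂ with hz
  have hzc : ∀ c : ℂ, (c * z).re = 0 := by
    intro c
    have := hlin c
    rw [inner_smul_right] at this
    have hwk : (w k : ℝ) ≠ 0 := (hw k).ne'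
    rw [hz]
    simp only [RCLike.re_to_complex, Complex.mul_re, Complex.sub_re, Complex.sub_im, Complex.div_ofReal_re,
      Complex.div_ofReal_im] at this ⊢
    field_simp at this
    field_simp
    linarith
  have hz0 : z = 0 := by
    have h := hzc (conj z)
    rw [mul_comm, Complex.mul_conj, Complex.ofReal_re] at h
    exact Complex.normSq_eq_zero.1 h
  -- unpack z = 0
  have hwk : (w k : ℂ) ≠ 0 := by exact_mod_cast (hw k).ne'
  have : conj (b₀ k) = (w k : ℂ) * ⟪F, Φ k⟫_ℂ := by
    have := hz0; rw [hz, sub_eq_zero, div_eq_iff hwk] at this; rw [this]; ring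
  have := congrArg conj this
  simpa [inner_conj_symm] using this

/-- THE RIDGE PACKAGE: a coefficient vector `b` (the minimiser) whose residual `F = G − Σ b_j • Φ_j` satisfies the two value identities
`J b = ‖F‖² + Σ w_k ‖⟪Φ_k, F⟫‖²` and `⟪G, F⟫ = ‖F‖² + Σ w_k ‖⟪Φ_k, F⟫‖²` (in particular `⟪G, F⟫` is real and `≥ 0`). -/
theorem ridge_package {n : ℕ} (G : E) (Φ : Fin n → E) (w : Fin n → ℝ) (hw : ∀ k, 0 < w k) :
    ∃ b : Fin n → ℂ,
      J G Φ w b = ‖G - ∑ j, b j • Φ j‖ ^ 2 + ∑ k, w k * ‖⟪Φ k, G - ∑ j, b j • Φ j⟫_ℂ‖ ^ 2 ∧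
      ⟪G, G - ∑ j, b j • Φ j⟫_ℂ
        = ((‖G - ∑ j, b j • Φ j‖ ^ 2 + ∑ k, w k * ‖⟪Φ k, G - ∑ j, b j • Φ j⟫_ℂ‖ ^ 2 : ℝ) : ℂ) := by
  obtain ⟨b, hmin⟩ := J_exists_min G Φ w hw
  have hfoc := J_foc G Φ w hw b hmin
  refine ⟨b, ?_, ?_⟩
  · set F := G - ∑ j, b j • Φ j with hF
    unfold J
    rw [← hF]
    congr 1
    refine Finset.sum_congr rfl fun k _ ↦ ?_
    rw [hfoc k, norm_mul, Complex.norm_real, Real.norm_eq_abs, abs_of_pos (hw k)]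
    field_simp
  · set F := G - ∑ j, b j • Φ j with hF
    have hG : G = F + ∑ j, b j • Φ j := by rw [hF]; abel
    rw [show ⟪G, F⟫_ℂ = ⟪F + ∑ j, b j • Φ j, F⟫_ℂ by rw [← hG]]
    rw [inner_add_left, sum_inner, inner_self_eq_norm_sq_to_K]
    push_cast
    congr 1
    refine Finset.sum_congr rfl fun k _ ↦ ?_
    rw [inner_smul_left, hfoc k, map_mul, Complex.conj_ofReal, mul_assoc, mul_comm (conj _) _, Complex.mul_conj,
      Complex.normSq_eq_norm_sq]
    push_cast
    ring

end KCertRidge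

namespace KCertBridge

section LpBridges
variable {α : Type*} [MeasurableSpace α] {μ : Measure α}

/-- ★-row port (x-wuc G11b «row ★₁₀₂₄ʳ», verbatim): auxiliary lemma `coeFn_finset_sum` of the chain HSW → K1′ → (RH ⟺ RH(e^1024) ∧ B′₁) — see the module docstring of part A. -/
theorem coeFn_finset_sum {ι : Type*} (s : Finset ι) (f : ι → Lp ℂ 2 μ) :
    ⇑(∑ i ∈ s, f i) =ᵐ[μ] fun x ↦ ∑ i ∈ s, (f i : α → ℂ) x := by
  classical
  induction s using Finset.induction_on with
  | empty =>
    simp only [Finset.sum_empty]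
    filter_upwards [Lp.coeFn_zero ℂ 2 μ] with x hx
    simpa using hx
  | insert a s ha ih =>
    rw [Finset.sum_insert ha]
    filter_upwards [Lp.coeFn_add (f a) (∑ i ∈ s, f i), ih] with x hx hih
    rw [hx, Pi.add_apply, hih, Finset.sum_insert ha]

end LpBridges

/-- Conjugate of the sampling kernel: `conj (cosh(κu) e^{-iλu}) = cosh(κu) e^{iλu}`. -/
theorem conj_kernel (κ lam u : ℝ) :
    conj ((Real.cosh (κ * u) : ℂ) * cexp (-(I * (lam : ℂ) * u))) = (Real.cosh (κ * u) : ℂ) * cexp (I * (lam : ℂ) * u) := by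
  rw [map_mul, Complex.conj_ofReal, ← Complex.exp_conj]
  congr 2
  simp [Complex.conj_I, map_neg, map_mul, Complex.conj_ofReal]

end KCertBridge

/-- COUNTING LEMMA (card §16e, E): every admissible window carries real mass `≥ D(b − a) − δD − δD·[0 ∈ (a, b]]`. -/
theorem locBandL_mass_lower {L δ D Λ : ℝ} {n : ℕ} {lam w : Fin n → ℝ} {w₀ : ℝ} (hw₀' : w₀ ≤ δ * D)
    (h : LocBandL L δ D Λ lam w w₀) {a b : ℝ} (ha : -Λ ≤ a) (hab : a < b) (hb : b ≤ Λ) (hlen : b - a ≤ L) :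
    D * (b - a) - δ * D - (if a < 0 ∧ 0 ≤ b then δ * D else 0) ≤
      ∑ k ∈ Finset.univ.filter (fun k ↦ a < lam k ∧ lam k ≤ b), w k := by
  have h1 := (abs_le.1 (h a b ha hab hb hlen)).1
  by_cases h0 : a < 0 ∧ 0 ≤ b
  · rw [if_pos h0] at h1 ⊢; linarith
  · rw [if_neg h0] at h1 ⊢; linarith

/-- CERTIFICATE CHAIN (card §16e, E): for a finite interval certificate `(a_i, b_i], t_i ≥ 0` inside `[−Λ, Λ]` with windows `≤ L`,
`D · Σ_i t_i · credit_i ≤ Σ_k w_k V_k` whenever `Σ_{i : λ_k ∈ (a_i, b_i]} t_i ≤ V_k` for every atom `k`. -/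
theorem cert_chain {L δ D Λ : ℝ} {n m : ℕ} {lam w : Fin n → ℝ} {w₀ : ℝ} (hw : ∀ k, 0 < w k)
    (hw₀' : w₀ ≤ δ * D) (hband : LocBandL L δ D Λ lam w w₀) {a b t : Fin m → ℝ}
    (hwin : ∀ i, -Λ ≤ a i ∧ a i < b i ∧ b i ≤ Λ ∧ b i - a i ≤ L ∧ 0 ≤ t i) {V : Fin n → ℝ}
    (hV : ∀ k, (∑ i ∈ Finset.univ.filter (fun i ↦ a i < lam k ∧ lam k ≤ b i), t i) ≤ V k) :
    D * ∑ i, t i * (b i - a i - δ - (if a i < 0 ∧ 0 ≤ b i then δ else 0)) ≤ ∑ k, w k * V k := by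
  classical
  -- step 1: counting lemma, window by window
  have step1 : D * ∑ i, t i * (b i - a i - δ - (if a i < 0 ∧ 0 ≤ b i then δ else 0))
      ≤ ∑ i, t i * ∑ k ∈ Finset.univ.filter (fun k ↦ a i < lam k ∧ lam k ≤ b i), w k := by
    rw [Finset.mul_sum]
    refine Finset.sum_le_sum fun i _ ↦ ?_
    obtain ⟨hai, habi, hbi, hli, hti⟩ := hwin i
    have hm := locBandL_mass_lower hw₀' hband hai habi hbi hli
    have : D * (b i - a i - δ - (if a i < 0 ∧ 0 ≤ b i then δ else 0))
        = D * (b i - a i) - δ * D - (if a i < 0 ∧ 0 ≤ b i then δ * D else 0) := by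
      split_ifs <;> ring
    calc D * (t i * (b i - a i - δ - if a i < 0 ∧ 0 ≤ b i then δ else 0))
        = t i * (D * (b i - a i - δ - if a i < 0 ∧ 0 ≤ b i then δ else 0)) := by ring
      _ ≤ t i * ∑ k ∈ Finset.univ.filter (fun k ↦ a i < lam k ∧ lam k ≤ b i), w k := by
          rw [this]; exact mul_le_mul_of_nonneg_left hm hti
  -- step 2: exchange the order of summation
  have step2 : ∑ i, t i * ∑ k ∈ Finset.univ.filter (fun k ↦ a i < lam k ∧ lam k ≤ b i), w k
      = ∑ k, w k * ∑ i ∈ Finset.univ.filter (fun i ↦ a i < lam k ∧ lam k ≤ b i), t i := by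
    simp only [Finset.sum_filter, Finset.mul_sum]
    rw [Finset.sum_comm]
    refine Finset.sum_congr rfl fun k _ ↦ Finset.sum_congr rfl fun i _ ↦ ?_
    split_ifs <;> ring
  -- step 3: the certificate condition at each atom
  have step3 : ∑ k, w k * ∑ i ∈ Finset.univ.filter (fun i ↦ a i < lam k ∧ lam k ≤ b i), t i ≤ ∑ k, w k * V k :=
    Finset.sum_le_sum fun k _ ↦ mul_le_mul_of_nonneg_left (hV k) (hw k).le
  linarith


end Summit.RiemannHypothesis.RiemannHypothesis.Theorems.Splittings.XWucG8

end
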